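/-
COR-CM (cell pub-hodgecm2, stage 2 of the Hodge ladder) — junction B01 `PerLFace_of_PerL`, sequel «LevelCovering» of
`HOME/b01/ROUTES-B01.md` §3 R1.  AUTHORED by seat b10 gen 14 (prover-pub-hodgecm2-b10-g14-0; staged bytes
`HOME/pub-hodgecm2-b10/gen14/B01LevelCovering.lean`, md5 b0154f73bdf0, farm rc 0 as a concatenation), FILED verbatim (this
header added) by the single owner of B01, prover-pub-hodgecm2-own-b01-0, per RULING LEVEL-COVER (b) (lead gen 5,
2026-08-21T05:43Z).  Theorems only; nothing cited beyond b10's tree twin `UnitaryBallLevelCovering`; nothing asserted.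
-/
import Summits.HodgeConjecture.CorCM.Model.Universe
import Literature.AlgebraicGeometry.ShimuraVarieties.UnitaryBallLevelCovering
import Literature.NumberTheory.Transcendental.AnalytificationMorphismsProofs
import HarnessLib

/-!
# COR-CM — the level coverings `X_{Γ'} ⟶ X_Γ` of the model universe are morphisms (`U.Mor`)

Port (cell pub-hodgecm2, junction B01, sequel «LevelCovering» of `HOME/b01/ROUTES-B01.md` §3 R1) of the stage-1
package module `HodgeCM/Model/CoverInstance.lean` (pub-hodgecm, seat mc-glue-1 gen 2; package md5 002f6e63803d,
194 l.) to the tree's model universe `Model.universeOf` / `Model.picardCMUniverse`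
(`CorCM/Model/Universe.lean`), over the tree twin `UnitaryBallLevelCovering.exists_hom_map_unif_eq` of the package's
`LevelCovering` module.  Differences from the package, all forced by the tree: (1) the record
`Arapura2012_Cor_15_4_6` is DISCHARGED (`arapura2012_cor_15_4_6_holds`), so every statement below is
hypothesis-free where the package took `hA`; (2) the package's field-level anisotropy predicate
`HodgeCM.IsAnisotropic L V.Hm` (module `Automorphic/AdelicUnitaryModel`, off the COR-CM path and not ported) is
replaced by the tree's code-level `PicardCode.IsAnisotropic (pmsCode L ι₁ V Γ)`, which does not depend on the
level (`isAnisotropic_pmsCode_iff_of_level`, `Iff.rfl`) and holds whenever `2 < [L:ℚ]`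
(`isAnisotropic_pmsCode_of_two_lt`, from `PicardCode.isAnisotropic_ofHermitian`) — in particular at every face
context of `Universe.PeriodThmF` (`6 ≤ [F:ℚ]`); (3) the package's `ballDatumOf` abbreviation is spelled out as
`Var.ballDatum (ballQuotientUniformisedDatum_of h₁) h₃ (pmsCode L ι₁ V Γ) _`.

For two levels `Γ' ≤ Γ` (`hle : Γ'.Γ ≤ Γ.Γ`) of ONE hermitian space `V : HermSpace3 L ι₁`:

* `ballDatum_Hℂ_eq`, `ballDatum_map_Γ_le` — the two ball data of the realising surfaces have the same complex
  Gram matrix and nested groups in `GL₃(ℂ)` (clauses `datum_H`, `datum_Γ` of `pmsRealisation`);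
* `exists_levelCover` — in the anisotropic regime there is a morphism of the realising `ℂ`-schemes
  `g : X_{Γ'} ⟶ X_Γ` with `g(ℂ) (unif_{Γ'} v) = unif_Γ v` on the negative cone (the level covering of the
  analytifications is holomorphic, `UnitaryBallLevelCovering.mdifferentiable_levelMap`, hence algebraic,
  `arapura2012_cor_15_4_6_holds`);
* `exists_mor_pms_map_unif` — the same on the universe of record `U = picardCMUniverse hHD hI h₁ h₃`:
  `∃ g : U.Mor (U.pms L ι₁ V Γ') (U.pms L ι₁ V Γ), g(ℂ) ∘ unif_{Γ'} = unif_Γ` on the cone (what an existential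
  consumer such as a coupling statement `∃ Γ' (g : U.Mor (U.pms F ι₁ V Γ') (U.pms F ι₁ V Γ)) …` needs), and
  `nonempty_mor_pms_of_le` / `nonempty_mor_pms_of_two_lt` (`U.Mor (U.pms L ι₁ V Γ') (U.pms L ι₁ V Γ)` is inhabited).

The file declares NO definitions (the package's chosen terms `levelCover` / `coverOf` are, if wanted,
`(exists_levelCover …).choose` / `(exists_mor_pms_map_unif …).choose` in a definition-bearing file); no property
of the covering other than the junction over the uniformisations is asserted.

References: N. Bergeron, J. Millson, C. Moeglin, Acta Math. 216 (2016), Introduction §1.1 (the tower of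
congruence ball quotients); D. Arapura, *Algebraic Geometry over the Complex Numbers* (2012), §15.4 Cor. 15.4.6.
-/

noncomputable section

open scoped Matrix ComplexOrder
open NumberField CategoryTheory
open Literature.AlgebraicGeometry.Motives
open Literature.AlgebraicGeometry.ShimuraVarieties
open Literature.NumberTheory.Transcendental (Arapura2012_Cor_15_4_6 arapura2012_cor_15_4_6_holds)

namespace Summit.HodgeConjecture.CorCM

namespace Model

open Literature.NumberTheory.Automorphic.PicardCM
open Literature.AlgebraicGeometry.HodgeTheory

section Codes

variable {L : CMField} {ι₁ : L →+* ℂ} {V : HermSpace3 L ι₁}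

/-- The codes of two levels of one hermitian space have the same field (by construction of
`pmsCode` / `PicardCode.ofHermitian`). [folklore] -/
theorem pmsCode_E (Γ Γ' : Level V) : (pmsCode L ι₁ V Γ').E = (pmsCode L ι₁ V Γ).E := rfl

/-- … and the same Gram matrix. [folklore] -/
theorem pmsCode_H (Γ Γ' : Level V) : (pmsCode L ι₁ V Γ').H = (pmsCode L ι₁ V Γ).H := rfl

/-- … and nested groups when `Γ' ≤ Γ`. [folklore] -/
theorem pmsCode_Γ_le {Γ Γ' : Level V} (hle : Γ'.Γ ≤ Γ.Γ) :
    (pmsCode L ι₁ V Γ').Γ ≤ (pmsCode L ι₁ V Γ).Γ :=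
  Subgroup.map_mono hle

/-- Anisotropy of the code does not depend on the level (the predicate only reads the field and the Gram
matrix of the code, which are those of `V`). [folklore] -/
theorem isAnisotropic_pmsCode_iff_of_level (Γ Γ' : Level V) :
    (pmsCode L ι₁ V Γ').IsAnisotropic ↔ (pmsCode L ι₁ V Γ).IsAnisotropic :=
  Iff.rfl

/-- The code of a level is anisotropic as soon as `2 < [L:ℚ]` (`PicardCode.isAnisotropic_ofHermitian`: a CM field
of degree `> 2` has two complex places) — e.g. at every face context (`6 ≤ [F:ℚ]`). [folklore] -/
theorem isAnisotropic_pmsCode_of_two_lt (hL : 2 < Module.finrank ℚ L) (Γ : Level V) :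
    (pmsCode L ι₁ V Γ).IsAnisotropic :=
  PicardCode.isAnisotropic_ofHermitian ι₁ V.Hm Γ.Γ V.isHermitian V.signature_ι₁ V.posDef_of_ne
    Γ.isCongruence Γ.torsionFree hL

end Codes

section Data

variable (hU : BallQuotientUniformisedDatum) (h₃ : CMAbelianVarietyRealised)
variable {L : CMField} {ι₁ : L →+* ℂ} {V : HermSpace3 L ι₁}

/-- The two ball data of nested levels have THE SAME complex Gram matrix (clause `datum_H` of the
realisation, twice). [folklore] -/
theorem ballDatum_Hℂ_eq (Γ Γ' : Level V) (h' : (pmsCode L ι₁ V Γ').IsAnisotropic)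
    (h : (pmsCode L ι₁ V Γ).IsAnisotropic) :
    (Var.ballDatum hU h₃ (pmsCode L ι₁ V Γ') h').Hℂ = (Var.ballDatum hU h₃ (pmsCode L ι₁ V Γ) h).Hℂ := by
  change ((pmsRealisation hU _).datum h').H.map ((pmsRealisation hU _).datum h').E.subtype =
    ((pmsRealisation hU _).datum h).H.map ((pmsRealisation hU _).datum h).E.subtype
  rw [(pmsRealisation hU (pmsCode L ι₁ V Γ')).datum_H h', (pmsRealisation hU (pmsCode L ι₁ V Γ)).datum_H h]
  rfl

/-- … and NESTED groups read in `GL₃(ℂ)` (clause `datum_Γ`, twice, and `Γ' ≤ Γ`). [folklore] -/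
theorem ballDatum_map_Γ_le {Γ Γ' : Level V} (hle : Γ'.Γ ≤ Γ.Γ)
    (h' : (pmsCode L ι₁ V Γ').IsAnisotropic) (h : (pmsCode L ι₁ V Γ).IsAnisotropic) :
    (Var.ballDatum hU h₃ (pmsCode L ι₁ V Γ') h').Γ.map
        (Matrix.GeneralLinearGroup.map (Var.ballDatum hU h₃ (pmsCode L ι₁ V Γ') h').τ₁) ≤
      (Var.ballDatum hU h₃ (pmsCode L ι₁ V Γ) h).Γ.map
        (Matrix.GeneralLinearGroup.map (Var.ballDatum hU h₃ (pmsCode L ι₁ V Γ) h).τ₁) := by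
  change ((pmsRealisation hU _).datum h').Γ.map
      (Matrix.GeneralLinearGroup.map ((pmsRealisation hU _).datum h').E.subtype) ≤
    ((pmsRealisation hU _).datum h).Γ.map
      (Matrix.GeneralLinearGroup.map ((pmsRealisation hU _).datum h).E.subtype)
  rw [(pmsRealisation hU (pmsCode L ι₁ V Γ')).datum_Γ h', (pmsRealisation hU (pmsCode L ι₁ V Γ)).datum_Γ h]
  exact Subgroup.map_mono (pmsCode_Γ_le hle)

/-- Off the anisotropic regime the realising scheme is the total branch `ℙ²`. [folklore] -/
theorem scheme_pms_of_not_isAnisotropic (c : PicardCode) (hc : ¬ c.IsAnisotropic) :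
    Var.scheme hU h₃ (.pms c) = projectiveSpace 2 ℂ := by
  rw [Var.scheme_pms, pmsRealisation, dif_neg hc]

/-- **The level covering is a morphism of the realising schemes** (anisotropic regime): from the kernel theorem
`UnitaryBallLevelCovering.exists_hom_map_unif_eq` on the two ball data (same `Hℂ`, nested groups), read in the
chosen real Hodge models `BettiUniverse.realHodgeModel hHD`, with the record `Arapura2012_Cor_15_4_6` discharged by
the tree theorem `arapura2012_cor_15_4_6_holds`.
[cite: BergeronMillsonMoeglin2016Balls, Introduction §1.1] [cite: Arapura2012, §15.4 Cor. 15.4.6] -/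
theorem exists_levelCover (hHD : exists_isReal_hodgeModel) {Γ Γ' : Level V} (hle : Γ'.Γ ≤ Γ.Γ)
    (h' : (pmsCode L ι₁ V Γ').IsAnisotropic) (h : (pmsCode L ι₁ V Γ).IsAnisotropic) :
    ∃ g : Var.scheme hU h₃ (.pms (pmsCode L ι₁ V Γ')) ⟶ Var.scheme hU h₃ (.pms (pmsCode L ι₁ V Γ)),
      ∀ v ∈ (Var.ballDatum hU h₃ (pmsCode L ι₁ V Γ') h').cone,
        AlgPoints.map g ((Var.ballDatum hU h₃ (pmsCode L ι₁ V Γ') h').unif v) =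
          (Var.ballDatum hU h₃ (pmsCode L ι₁ V Γ) h).unif v :=
  UnitaryBallLevelCovering.exists_hom_map_unif_eq arapura2012_cor_15_4_6_holds
    (ballDatum_Hℂ_eq hU h₃ Γ Γ' h' h) (ballDatum_map_Γ_le hU h₃ hle h' h)
    (BettiUniverse.realHodgeModel hHD (Var.isSmoothProjective hU h₃ (.pms (pmsCode L ι₁ V Γ'))))
    (BettiUniverse.realHodgeModel hHD (Var.isSmoothProjective hU h₃ (.pms (pmsCode L ι₁ V Γ))))

end Data

/-! ### On the universe of record `picardCMUniverse` -/

section EndState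

variable (hHD : exists_isReal_hodgeModel) (hI : hodgePQ_independent_of_hodgeModel)
  (h₁ : BallQuotientUniformised) (h₃ : CMAbelianVarietyRealised)

/-- **The level covering of the universe of record is a morphism**: for levels `Γ' ≤ Γ` of an anisotropic
hermitian space there is `g : U.Mor (U.pms L ι₁ V Γ') (U.pms L ι₁ V Γ)`, `U = picardCMUniverse hHD hI h₁ h₃`, lying
over the uniformisations (`U.pms L ι₁ V Γ = .pms (pmsCode L ι₁ V Γ)` and
`U.Mor X Y = (Var.scheme _ _ X ⟶ Var.scheme _ _ Y)` by `rfl`).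
[cite: BergeronMillsonMoeglin2016Balls, Introduction §1.1] [cite: Arapura2012, §15.4 Cor. 15.4.6] -/
theorem exists_mor_pms_map_unif {L : CMField} {ι₁ : L →+* ℂ} {V : HermSpace3 L ι₁} {Γ Γ' : Level V}
    (hle : Γ'.Γ ≤ Γ.Γ) (h : (pmsCode L ι₁ V Γ).IsAnisotropic) :
    ∃ g : (picardCMUniverse hHD hI h₁ h₃).Mor ((picardCMUniverse hHD hI h₁ h₃).pms L ι₁ V Γ')
        ((picardCMUniverse hHD hI h₁ h₃).pms L ι₁ V Γ),
      ∀ v ∈ (Var.ballDatum (ballQuotientUniformisedDatum_of h₁) h₃ (pmsCode L ι₁ V Γ')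
          ((isAnisotropic_pmsCode_iff_of_level Γ Γ').2 h)).cone,
        AlgPoints.map g ((Var.ballDatum (ballQuotientUniformisedDatum_of h₁) h₃ (pmsCode L ι₁ V Γ')
            ((isAnisotropic_pmsCode_iff_of_level Γ Γ').2 h)).unif v) =
          (Var.ballDatum (ballQuotientUniformisedDatum_of h₁) h₃ (pmsCode L ι₁ V Γ) h).unif v :=
  exists_levelCover (ballQuotientUniformisedDatum_of h₁) h₃ hHD hle
    ((isAnisotropic_pmsCode_iff_of_level Γ Γ').2 h) h

/-- In particular `U.Mor (U.pms L ι₁ V Γ') (U.pms L ι₁ V Γ)` of the universe of record is inhabited for all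
levels `Γ' ≤ Γ` of an anisotropic hermitian space. [cite: BergeronMillsonMoeglin2016Balls, Introduction §1.1] -/
theorem nonempty_mor_pms_of_le {L : CMField} {ι₁ : L →+* ℂ} {V : HermSpace3 L ι₁} {Γ Γ' : Level V}
    (hle : Γ'.Γ ≤ Γ.Γ) (h : (pmsCode L ι₁ V Γ).IsAnisotropic) :
    Nonempty ((picardCMUniverse hHD hI h₁ h₃).Mor ((picardCMUniverse hHD hI h₁ h₃).pms L ι₁ V Γ')
      ((picardCMUniverse hHD hI h₁ h₃).pms L ι₁ V Γ)) :=
  let ⟨g, _⟩ := exists_mor_pms_map_unif hHD hI h₁ h₃ hle h; ⟨g⟩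

/-- … and for every CM field of degree `> 2` (every face context, `6 ≤ [F:ℚ]`), anisotropy being automatic
(`isAnisotropic_pmsCode_of_two_lt`). [cite: BergeronMillsonMoeglin2016Balls, Introduction §1.1] -/
theorem nonempty_mor_pms_of_two_lt {L : CMField} (hL : 2 < Module.finrank ℚ L) {ι₁ : L →+* ℂ}
    {V : HermSpace3 L ι₁} {Γ Γ' : Level V} (hle : Γ'.Γ ≤ Γ.Γ) :
    Nonempty ((picardCMUniverse hHD hI h₁ h₃).Mor ((picardCMUniverse hHD hI h₁ h₃).pms L ι₁ V Γ')
      ((picardCMUniverse hHD hI h₁ h₃).pms L ι₁ V Γ)) :=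
  nonempty_mor_pms_of_le hHD hI h₁ h₃ hle (isAnisotropic_pmsCode_of_two_lt hL Γ)

end EndState

end Model

end Summit.HodgeConjecture.CorCM

end
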